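import Summits.CriticalPhenomena.PercolationContinuityZ3.Theorems.PercNearOneGluingNoHeavyLowerTailIncStarWDOMBottomSink
import HarnessLib

/-!
# `W` is positively correlated with a lone extra root pair (Sahi programme, prover prim-sahi-p2 gen 36)

Support file (`--supports stmt-CriticalPhenomena-4575`); no definitions, no named facts, no sorries; standard axioms.  Memo
`run/shared/lean/prim/prim-sahi/FROM-prim-sahi-p2-gen36-ALL-OR-NOTHING.md` §2, `prim-sahi-p2/PROOF-E3.md` §46.

If the root `s` has, besides the target pairs `s–i`, `s–j`, exactly ONE further pair `e = s–x` of positive weight (`x` and the rest of the graph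
arbitrary), then `Cov(W, 1{e open}) ≥ 0`: **`cov_W_lonePair_nonneg`**,
`r·(2q_{ij} − 2q_iq_j) ≤ 2·P(B_i ∩ B_j ∩ {e open}) − q_i·P(B_j ∩ {e open}) − q_j·P(B_i ∩ {e open})`, `r = w(e)`.
This is the case `F = {e}` of `bottomSink` (gen-35 memo §11c observed it numerically, 0/3 888; for a pair competing with OTHER random root pairs it is
false — the PIV corner).  Proof: `bottomSink` with `F = {e}` and the one-pair decomposition `P(X ∩ {e closed}) = (1−r)·P_{w[e↦0]}(X)`.
-/

noncomputable section

namespace Summit.CriticalPhenomena.PercolationContinuityZ3.Theorems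

namespace IncStar

open MeasureTheory Set Literature.Probability.Percolation Literature.Probability.LatticeModels EdgeInduction
open scoped Classical

variable {n : ℕ}

/-- One-pair decomposition on the closed half: `P_w(X ∖ {e open}) = (1 − w e)·P_{w[e↦0]}(X)`. [folklore] -/
theorem real_sdiff_open_eq (w : Sym2 (Fin n) → unitInterval) (e : Sym2 (Fin n)) (X : Set (BondConfig (Fin n))) :
    (prodBernoulli w).real (X \ {ω | e ∈ ω}) = (1 - (w e : ℝ)) * (prodBernoulli (Function.update w e 0)).real X := by
  rw [stub_oneBondDecomp_k15 n w e (X \ {ω | e ∈ ω})]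
  have s0 := real_sureSet (Function.update w e 0)
  have s1 := real_sureSet (Function.update w e 1)
  have h0 : (prodBernoulli (Function.update w e 0)).real (X \ {ω | e ∈ ω}) = (prodBernoulli (Function.update w e 0)).real X := by
    refine real_congr_on_sure s0 fun ω hω => ?_
    have he : e ∉ ω := hω.2 e (by simp)
    simp only [Set.mem_sdiff, Set.mem_setOf_eq]
    exact ⟨fun h => h.1, fun h => ⟨h, he⟩⟩
  have h1 : (prodBernoulli (Function.update w e 1)).real (X \ {ω | e ∈ ω}) = 0 := by
    have hz : (prodBernoulli (Function.update w e 1)).real (∅ : Set (BondConfig (Fin n))) = 0 := by simp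
    rw [← hz]
    refine real_congr_on_sure s1 fun ω hω => ?_
    have he : e ∈ ω := hω.1 e (by simp)
    simp only [Set.mem_sdiff, Set.mem_setOf_eq, Set.mem_empty_iff_false, iff_false, not_and, not_not]
    exact fun _ => he
  rw [h0, h1]; ring

/-- **`Cov(W, 1{e open}) ≥ 0` for a lone extra root pair.**  `s, i, j, x` distinct, every root pair other than `s–i`, `s–j`, `e = s–x` of weight `0`
(the rest of the graph arbitrary), `B_v = {s ↔ v}`, `q_v = P(B_v)`, `q_{ij} = P(B_i ∩ B_j)`, `r = w(e)`:
`r·(2q_{ij} − 2q_iq_j) ≤ 2·P(B_i ∩ B_j ∩ {e open}) − q_i·P(B_j ∩ {e open}) − q_j·P(B_i ∩ {e open})`. [this work] -/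
theorem cov_W_lonePair_nonneg (w : Sym2 (Fin n) → unitInterval) {s i j x : Fin n} (his : i ≠ s) (hjs : j ≠ s) (hij : i ≠ j)
    (hxs : x ≠ s) (hxi : x ≠ i) (hxj : x ≠ j)
    (hroot : ∀ v : Fin n, v ≠ s → v ≠ i → v ≠ j → v ≠ x → w s(s, v) = 0) :
    (w s(s, x) : ℝ) * (2 * (prodBernoulli w).real (openConn s i ∩ openConn s j)
        - 2 * ((prodBernoulli w).real (openConn s i) * (prodBernoulli w).real (openConn s j)))
      ≤ 2 * (prodBernoulli w).real (openConn s i ∩ openConn s j ∩ {ω | s(s, x) ∈ ω})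
        - (prodBernoulli w).real (openConn s i) * (prodBernoulli w).real (openConn s j ∩ {ω | s(s, x) ∈ ω})
        - (prodBernoulli w).real (openConn s j) * (prodBernoulli w).real (openConn s i ∩ {ω | s(s, x) ∈ ω}) := by
  set e : Sym2 (Fin n) := s(s, x) with he
  set Bi : Set (BondConfig (Fin n)) := openConn s i with hBi
  set Bj : Set (BondConfig (Fin n)) := openConn s j with hBj
  set P := prodBernoulli w with hP
  set P0 := prodBernoulli (Function.update w e 0) with hP0
  set r : ℝ := (w e : ℝ) with hr
  have hr1 : r ≤ 1 := (w e).2.2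
  -- `bottomSink` with `F = {e}`
  have hw0 : Function.update w e 0 = fun f => if f ∈ ({e} : Finset (Sym2 (Fin n))) then 0 else w f := by
    funext f
    by_cases hf : f = e
    · subst hf; simp
    · simp [hf]
  have hF : ∀ f ∈ ({e} : Finset (Sym2 (Fin n))), s ∈ f := by
    intro f hf; rw [Finset.mem_singleton] at hf; subst hf; rw [he]; exact Sym2.mem_mk_left _ _
  have hFi : s(s, i) ∉ ({e} : Finset (Sym2 (Fin n))) := by
    rw [Finset.mem_singleton, he]; exact fun h => (rootPair_ne_of_ne (s := s) hxi hxj).1 h.symm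
  have hFj : s(s, j) ∉ ({e} : Finset (Sym2 (Fin n))) := by
    rw [Finset.mem_singleton, he]; exact fun h => (rootPair_ne_of_ne (s := s) hxi hxj).2 h.symm
  have hcover : ∀ v : Fin n, v ≠ s → v ≠ i → v ≠ j → s(s, v) ∈ ({e} : Finset (Sym2 (Fin n))) ∨ w s(s, v) = 0 := by
    intro v hv hi hj
    by_cases hvx : v = x
    · subst hvx; left; rw [Finset.mem_singleton]
    · right; exact hroot v hv hi hj hvx
  have B := bottomSink w his hjs hij ({e} : Finset (Sym2 (Fin n))) hF hFi hFj hcover (Function.update w e 0) hw0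
  -- one-pair decompositions
  have hm : MeasurableSet {ω : BondConfig (Fin n) | e ∈ ω} := MeasurableSet.of_discrete
  have dIJ : P.real (Bi ∩ Bj ∩ {ω | e ∈ ω}) = P.real (Bi ∩ Bj) - (1 - r) * P0.real (Bi ∩ Bj) := by
    have h := measureReal_inter_add_sdiff (μ := P) (s := Bi ∩ Bj) hm
    rw [hP, real_sdiff_open_eq w e (Bi ∩ Bj)] at h
    rw [hP, hP0]; linarith
  have dI : P.real (Bi ∩ {ω | e ∈ ω}) = P.real Bi - (1 - r) * P0.real Bi := by
    have h := measureReal_inter_add_sdiff (μ := P) (s := Bi) hm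
    rw [hP, real_sdiff_open_eq w e Bi] at h
    rw [hP, hP0]; linarith
  have dJ : P.real (Bj ∩ {ω | e ∈ ω}) = P.real Bj - (1 - r) * P0.real Bj := by
    have h := measureReal_inter_add_sdiff (μ := P) (s := Bj) hm
    rw [hP, real_sdiff_open_eq w e Bj] at h
    rw [hP, hP0]; linarith
  rw [dIJ, dI, dJ]
  have hqi0 : 0 ≤ P.real Bi := measureReal_nonneg
  have hqj0 : 0 ≤ P.real Bj := measureReal_nonneg
  have key : (1 - r) * (2 * P0.real (Bi ∩ Bj) - P.real Bi * P0.real Bj - P.real Bj * P0.real Bi)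
      ≤ (1 - r) * (2 * P.real (Bi ∩ Bj) - 2 * (P.real Bi * P.real Bj)) :=
    mul_le_mul_of_nonneg_left (by rw [hP, hP0]; linarith [B]) (sub_nonneg.2 hr1)
  nlinarith [key]

end IncStar

end Summit.CriticalPhenomena.PercolationContinuityZ3.Theorems
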